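import Mathlib
import Summits.Ventures.HodgeRepro.Tier4.Line4.LevelShrink

/-!
# Tier4/Line4/LevelPhaseAbstract — PHASE-AT-P, the topological half: a continuous function of the fibre pairs that is
`1` on the `K^{(p)}`-fibre is uniformly close to `1` on the level fibres from some level on

Blind re-derivation cell `pub-hodge-repro`, Tier 4 «prove the step» (README §9–§10), seat t4-L4-p1 (prover, LINE L4,
gen 4; plan-4 g6's (2) S15640 — PHASE-AT-P split into its topological half (here) and its `p`-local content (the phase
`χ(b_S) · conj χ′(b′_S)` of L2-p1's `ofPlacesPart`, equal to `1` on the `K^{(p)}`-fibre by L1-p1's LinRegularLocal +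
`RTFData.chi_centre`, to be bound by name when PSPLIT serves)).  Tree path
`lean/Summits/Ventures/HodgeRepro/Tier4/Line4/LevelPhaseAbstract.lean`.  Mathlib-level; no literature.

WHAT IS PROVED.  `exists_level_phase_close_of_eq_one_on_limit`: let `C` be a compact set of torus pairs containing the
level fibres `suppSet γ₀ (p^N) γ ∩ (DZ_f × T′_f)` for `N ≥ n₁`, and `φ` a function continuous on `C` with `φ = 1` on the
`K^{(p)}`-fibre `{q ∈ C : orb q ∈ K^{(p)} γ₀,f K^{(p)}}` (`orb (b, b′) := b⁻¹ γ_f b′`).  Then for every `ε > 0` there is `N₀`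
with `‖φ q − 1‖ < ε` for every `q` in the level fibre (with `b ∈ DZ_f`) at every level `N ≥ N₀`.  Proof: `{q ∈ C : ‖φ q − 1‖
≥ ε}` is compact and misses the `K^{(p)}`-fibre, so its image under `orb` is a compact set missing the closed
`K^{(p)} γ₀,f K^{(p)}`; its complement is an open `U ⊇ K^{(p)} γ₀,f K^{(p)}`, and LevelShrink puts the level fibres inside
`orb⁻¹ U` from some level on.

Nothing here says anything about the status of the Hodge conjecture for CM abelian varieties, which is NOT proved
(HC_CM is NOT proved by anyone in this repository).
-/

set_option autoImplicit false

noncomputable section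

namespace Summit.Ventures.HodgeRepro.Tier4.Line4

open Summit.Ventures.HodgeRepro.Tier4.Common Summit.Ventures.HodgeRepro.Tier4.Line1 NumberField Topology
open scoped Pointwise

section PhaseAbstract

variable {k : Type} [Field k] [NumberField k] (W : PlaneData k)

/-- The orbit map of the fibre pairs, `(b, b′) ↦ b⁻¹ γ_f b′`. -/
def orbPair (γ : GA W) (q : torusFin W × torusFin' W) : GA W :=
  (((q.1 : torusT W) : GA W))⁻¹ * GA.ofFinPart W γ * ((q.2 : torusT' W) : GA W)

/-- `orbPair` is continuous. -/
theorem continuous_orbPair (γ : GA W) : Continuous (orbPair W γ) :=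
  ((continuous_subtype_val.comp (continuous_subtype_val.comp continuous_fst)).inv.mul continuous_const).mul
    (continuous_subtype_val.comp (continuous_subtype_val.comp continuous_snd))

/-- Membership in the level fibre, through `orbPair`. -/
theorem mem_suppSet_iff_orbPair (γ₀ : GA W) (N : ℕ) (γ : GA W) (q : torusFin W × torusFin' W) :
    q ∈ suppSet W γ₀ N γ ↔ orbPair W γ q ∈ levelDoubleCoset W N (GA.ofFinPart W γ₀) := Iff.rfl

/-- **PHASE-AT-P, the topological half.**  `C` compact contains the level fibres (first coordinate in `DZ_f`) from the level
`n₁` on; `φ` is continuous on `C` and equals `1` on the `K^{(p)}`-fibre inside `C`.  Then `φ` is uniformly `ε`-close to `1`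
on the level fibres from some level on. -/
theorem exists_level_phase_close_of_eq_one_on_limit {p : ℕ} (hp : p ≠ 0) (γ₀ γ : GA W) (DZf : Set (torusFin W))
    (C : Set (torusFin W × torusFin' W)) (hC : IsCompact C) (n₁ : ℕ)
    (hsub : ∀ N ≥ n₁, ∀ q ∈ suppSet W γ₀ (p ^ N) γ, q.1 ∈ DZf → q ∈ C)
    (φ : torusFin W × torusFin' W → ℂ) (hφ : ContinuousOn φ C)
    (hφ1 : ∀ q ∈ C, (∃ a ∈ levelKInf W p, ∃ c ∈ levelKInf W p, orbPair W γ q = a * GA.ofFinPart W γ₀ * c) →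
      φ q = 1)
    {ε : ℝ} (hε : 0 < ε) :
    ∃ N₀ : ℕ, ∀ N ≥ N₀, ∀ q ∈ suppSet W γ₀ (p ^ N) γ, q.1 ∈ DZf → ‖φ q - 1‖ < ε := by
  haveI : T2Space (GA W) := t2Space_GA W
  -- the bad set: far from `1` inside `C`
  set B : Set (torusFin W × torusFin' W) := {q ∈ C | ε ≤ ‖φ q - 1‖} with hB
  have hBc : IsCompact B := by
    have hcl : IsClosed {q ∈ C | ε ≤ ‖φ q - 1‖} := by
      have h1 : ContinuousOn (fun q => ‖φ q - 1‖) C := (hφ.sub continuousOn_const).norm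
      exact ContinuousOn.preimage_isClosed_of_isClosed h1 hC.isClosed isClosed_Ici
    exact hC.of_isClosed_subset hcl fun q hq => hq.1
  -- its image under the orbit map misses the limit double coset
  set U : Set (GA W) := (orbPair W γ '' B)ᶜ with hU
  have hUo : IsOpen U := (hBc.image (continuous_orbPair W γ)).isClosed.isOpen_compl
  have hKU : ∀ x, (∃ a ∈ levelKInf W p, ∃ c ∈ levelKInf W p, x = a * GA.ofFinPart W γ₀ * c) → x ∈ U := by
    rintro x hx ⟨q, hqB, hqx⟩
    have h1 : φ q = 1 := hφ1 q hqB.1 (by rw [hqx]; exact hx)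
    have h2 : ε ≤ ‖φ q - 1‖ := hqB.2
    rw [h1, sub_self, norm_zero] at h2
    exact absurd h2 (not_le.2 hε)
  obtain ⟨N₀, hN₀⟩ := exists_suppSet_pow_subset W hp γ₀ γ hUo hKU
  refine ⟨max N₀ n₁, fun N hN q hq hqD => ?_⟩
  have hqC : q ∈ C := hsub N (le_trans (le_max_right _ _) hN) q hq hqD
  have hqU : orbPair W γ q ∈ U := hN₀ N (le_trans (le_max_left _ _) hN) hq
  by_contra hcon
  exact hqU ⟨q, ⟨hqC, not_lt.1 hcon⟩, rfl⟩

end PhaseAbstract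

end Summit.Ventures.HodgeRepro.Tier4.Line4

end
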